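import Summits.BirchSwinnertonDyer.BirchSwinnertonDyer.Theorems.SmallImageMuTransferAnalyticMuZeroX9TeichSpanDefs
import HarnessLib
import HarnessLib.Audit.Tags

/-!
# Route `SignedLowerHalves`, crux `KobayashiMainConjectureSmallImage` (item stmt-BirchSwinnertonDyer-19002), line `birth_acns` v11,
# stub `stub_muOneSign_ns_ge5`: **B⁰_ss — the SUPERSINGULAR-ONLY weakening of Conjecture B⁰** (definitions + bookkeeping;
# cell `bsd-ssimc`, seat `bsd-line-slh-p3` gen 10, LEAD)

State before this file (gens 8–9: p645198 `…SmallImageTeichOrbitMu`, p648205 `…SmallImageTeichOrbitMuLevel`): the `p ≥ 5` one-sign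
μ-rider of crux 4 ⟸ CONJ B⁰ `TeichSpanGen N p` at the conductor level of the pair (f3-mu vocabulary
`…AnalyticMuZeroX9TeichSpanDefs`).  B⁰ at `(N, p)` says: for every good `γ ∈ Γ₀(N)` (`|d| = pᵐ`) the `ι`-norm `γ·γ^ι` lies in
`⟨packet products, finite order, trace ±2, p-th powers⟩·[Γ₀(N),Γ₀(N)]`; through Manin's homomorphism it is a statement about EVERY
`ι`-even additive functional on the `p`-power winding classes, in particular about the plus symbols of every ORDINARY and every
EISENSTEIN eigensystem of level `N` — it contains Greenberg's `μ(ω⁰) = 0` for all of them.  The rider only concerns SUPERSINGULAR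
eigensystems (`a_p ≡ 0 (mod p)`), whose plus functional `φ_f` KILLS THE IMAGE OF `T_p`.  So the rider needs the Teichmüller span only
MODULO the `T_p`-images of the winding classes.  This file names that weaker statement, in the same `Γ₀(N)` vocabulary:

* `heckePImages N p` — the «`T_p`-images» of the `p`-power cusp classes, as elements of `Γ₀(N)`: for a cusp `b/p^{n+1}` (`n ≥ 0`),
  the product of `p` elements `g_j` with `d(g_j) = p^{n+2}` whose `b`-entries are the `p` lifts of `b mod p^{n+1}` to `ℤ/p^{n+2}`,
  times one element `δ` with `d(δ) = pⁿ`, `b(δ) ≡ b (mod pⁿ)`.  Under Manin's map `γ ↦ {0 → γ·0}` this product goes to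
  `Σ_j {0 → (b + j p^{n+1})/p^{n+2}} + {0 → b/pⁿ} = T_p{0 → b/p^{n+1}} + Σ_{0<j<p} {0 → j/p}` (MTT §I.4 (4.2): `T_p = Σ_j (1 j; 0 p) + (p 0; 0 1)`
  on paths from `0`; the correction is the level-1 packet, itself a generator of B⁰), so for a weight-2 eigenform with
  `a_p [r]⁺ = Σ_j [(r+j)/p]⁺ + [pr]⁺` its Manin value is `2(a_p [b/p^{n+1}]⁺ − (p+1)[0]⁺)`.
* `teichSpanHeckeGenerators N p = teichSpanGenerators N p ∪ heckePImages N p`.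
* `TeichSpanGenModHecke N p` — **B⁰_ss(N,p)**: every good `γ` has `γ·γ^ι ∈ ⟨teichSpanHeckeGenerators N p⟩·[Γ₀(N),Γ₀(N)]`.
  Homologically (Manin 1972 Prop. 1.4): `(1+ι)·V(N,p) ⊆ span_{𝔽_p}{A_n(u)} + T_p·V(N,p)` — B⁰ asks the same WITHOUT the `T_p·V` term.
  Since the packet span is `T_p`-stable (orbit-summed (4.2), `…TeichSpanOrbitHecke`), B⁰_ss(N,p) is B⁰ restricted to the generalised
  `0`-eigenspace of `T_p` on the quotient: it says nothing about ordinary or Eisenstein eigensystems.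
* `TeichSpanGenModHeckeAll` — B⁰_ss at every `p ≥ 5` and every level prime to `p`.
* bookkeeping (all proved): `teichSpanGenModHecke_of_teichSpanGen` (B⁰ ⟹ B⁰_ss, `closure_mono`), the `All` version, membership
  constructors, unfolding lemmas.
HONEST FRAMING: predicates only; B⁰_ss is weaker than the OPEN conjecture B⁰ but is itself NOT proved here or anywhere in the tree (it
contains the one-signed Perrin-Riou conjecture `min(μ⁺,μ⁻)(g,ω⁰) = 0` for every residually supersingular weight-2 eigensystem of level
`N`, Pollack–Weston 2011 Rem. 4.2); nothing is asserted about any level or curve.  The consumer (`…SmallImageTeichSpanHecke.lean`, this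
seat) proves «rider ⟸ B⁰_ss at the conductor level».  Crux 4 stays OPEN; BSD is not proved by any of this; no summit statement is proved
by this seat.
References: [Manin1972] Prop. 1.4; [MazurTateTeitelbaum1986Invent] §I.4 (4.2), §I.10 (10.1)–(10.2); [PollackWeston2011] Thm. 4.1, Rem. 4.2;
[Sun2007] §4.
-/

-- D-0017: single-problem summit, the namespace repeats the problem name by design.
set_option linter.dupNamespace false
set_option autoImplicit false

noncomputable section

open scoped Classical MatrixGroups
open CongruenceSubgroup
open Literature.NumberTheory.EllipticCurves.Rank1Residual

namespace Summit.BirchSwinnertonDyer.BirchSwinnertonDyer.Theorems.SmallImageTeichSpanHecke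

open Summit.BirchSwinnertonDyer.BirchSwinnertonDyer.Cruxes.AnalyticMuZeroX9.TeichSpan

variable {N : ℕ}

/-- **The `T_p`-images of the `p`-power cusp classes, as elements of `Γ₀(N)`.**  For a level `n ≥ 0` and an integer `b`: a product
`g_0 ⋯ g_{p-1} · δ` where the `g_j ∈ Γ₀(N)` have `d(g_j) = p^{n+2}` and `b`-entries running ONCE through the `p` lifts of
`b mod p^{n+1}` to `ℤ/p^{n+2}` (pairwise distinct mod `p^{n+2}`, all `≡ b (mod p^{n+1})`), and `δ ∈ Γ₀(N)` has `d(δ) = pⁿ`,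
`b(δ) ≡ b (mod pⁿ)`.  Under Manin's homomorphism `γ ↦ {0 → γ·0} = {0 → b(γ)/d(γ)}` it is
`Σ_j {0 → (b + j p^{n+1})/p^{n+2}} + {0 → b/pⁿ}`, the right-hand side of the Hecke relation
`a_p [b/p^{n+1}]⁺ = Σ_j [(b/p^{n+1} + j)/p]⁺ + [p·b/p^{n+1}]⁺` (paths from `0`; the `p − 1` correction terms `{0 → j/p}` form the level-1
Teichmüller packet).  A SET of elements of `Γ₀(N)`; nothing asserted.
[cite: MazurTateTeitelbaum1986Invent, §I.4 (4.2)] [cite: Manin1972, Prop. 1.4] -/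
def heckePImages (N p : ℕ) : Set (Gamma0 N) :=
  {R | ∃ (n : ℕ) (b : ℤ) (l : List (Gamma0 N)) (δ : Gamma0 N),
    l.length = p ∧
    (∀ g ∈ l, dEntry g = (p : ℤ) ^ (n + 2) ∧ ((bEntry g : ℤ) : ZMod (p ^ (n + 1))) = (b : ZMod (p ^ (n + 1)))) ∧
    (l.map fun g => ((bEntry g : ℤ) : ZMod (p ^ (n + 2)))).Nodup ∧
    dEntry δ = (p : ℤ) ^ n ∧ ((bEntry δ : ℤ) : ZMod (p ^ n)) = (b : ZMod (p ^ n)) ∧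
    R = l.prod * δ}

/-- The generating set of B⁰_ss: the generators of B⁰ (`teichSpanGenerators N p`: packet products, finite-order and trace-`±2`
elements, `p`-th powers) together with the `T_p`-images `heckePImages N p`. [cite: Manin1972, Prop. 1.4] [cite: MazurTateTeitelbaum1986Invent, §I.4 (4.2)] -/
def teichSpanHeckeGenerators (N p : ℕ) : Set (Gamma0 N) :=
  teichSpanGenerators N p ∪ heckePImages N p

/-- **B⁰_ss(N,p) — `TeichSpanGenModHecke N p`** (Teichmüller-averaged generation MODULO `T_p`): for every GOOD `γ ∈ Γ₀(N)`
(`|d| = pᵐ`) the `ι`-norm `γ·γ^ι` lies in the subgroup generated by `teichSpanHeckeGenerators N p`, times the commutator subgroup.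
Through Manin 1972 Prop. 1.4: `(1+ι)·V(N,p) ⊆ span_{𝔽_p}{A_n(u)} + T_p·V(N,p)` on the `p`-power winding classes mod `p` — CONJ B⁰
(`TeichSpanGen N p`) without its ordinary / Eisenstein content.  A PREDICATE on `(N,p)`; OPEN; nothing asserted.
[cite: Manin1972, Prop. 1.4] [cite: MazurTateTeitelbaum1986Invent, §I.4 (4.2), §I.10 (10.1)] [cite: Sun2007, §4] -/
def TeichSpanGenModHecke (N p : ℕ) : Prop :=
  ∀ γ : Gamma0 N, IsGoodAt p γ →
    γ * iotaGamma0 γ ∈ Subgroup.closure (teichSpanHeckeGenerators N p) ⊔ commutator (Gamma0 N)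

/-- **B⁰_ss at all levels**: `TeichSpanGenModHecke N p` for every prime `p ≥ 5` and every level `N` prime to `p` (the supersingular-only
weakening of the f3-mu cell's `TeichSpanGenAll`, same binders).  An OPEN CONJECTURE of the cell stated as a closed `Prop` (an obligation
node: provable / refutable by name) — NOT a published result, NOT a Literature fact, nothing asserted.  Vocabulary: Manin 1972 Prop. 1.4 and
Mazur–Tate–Teitelbaum 1986 §I.4 (4.2) (see `TeichSpanGenModHecke`); it contains the one-signed Perrin-Riou conjecture (Pollack–Weston 2011
Rem. 4.2) for every residually supersingular weight-2 eigensystem of every level prime to `p`. -/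
@[conjecture] def TeichSpanGenModHeckeAll : Prop := ∀ (N p : ℕ), p.Prime → 5 ≤ p → ¬ p ∣ N → TeichSpanGenModHecke N p

/-! ### Bookkeeping (all proved) -/

/-- Unfolding `TeichSpanGenModHecke`. [cite: Manin1972, Prop. 1.4] -/
theorem teichSpanGenModHecke_iff (N p : ℕ) :
    TeichSpanGenModHecke N p ↔ ∀ γ : Gamma0 N, IsGoodAt p γ →
      γ * iotaGamma0 γ ∈ Subgroup.closure (teichSpanHeckeGenerators N p) ⊔ commutator (Gamma0 N) := Iff.rfl

/-- Unfolding `TeichSpanGenModHeckeAll`. [cite: Manin1972, Prop. 1.4] -/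
theorem teichSpanGenModHeckeAll_iff :
    TeichSpanGenModHeckeAll ↔ ∀ (N p : ℕ), p.Prime → 5 ≤ p → ¬ p ∣ N → TeichSpanGenModHecke N p := Iff.rfl

/-- The generators of B⁰ are generators of B⁰_ss. [cite: Manin1972, Prop. 1.4] -/
theorem teichSpanGenerators_subset (N p : ℕ) : teichSpanGenerators N p ⊆ teichSpanHeckeGenerators N p :=
  Set.subset_union_left

/-- The `T_p`-images are generators of B⁰_ss. [cite: MazurTateTeitelbaum1986Invent, §I.4 (4.2)] -/
theorem heckePImages_subset (N p : ℕ) : heckePImages N p ⊆ teichSpanHeckeGenerators N p :=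
  Set.subset_union_right

/-- Membership in the generating set: either a B⁰ generator or a `T_p`-image. [cite: Manin1972, Prop. 1.4] -/
theorem mem_teichSpanHeckeGenerators_iff {N p : ℕ} (γ : Gamma0 N) :
    γ ∈ teichSpanHeckeGenerators N p ↔ γ ∈ teichSpanGenerators N p ∨ γ ∈ heckePImages N p := Iff.rfl

/-- Constructor for `heckePImages`: the product of the `p` lifts times the drop. [cite: MazurTateTeitelbaum1986Invent, §I.4 (4.2)] -/
theorem prod_mul_mem_heckePImages {p : ℕ} (n : ℕ) (b : ℤ) {l : List (Gamma0 N)} {δ : Gamma0 N} (hlen : l.length = p)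
    (hl : ∀ g ∈ l, dEntry g = (p : ℤ) ^ (n + 2) ∧ ((bEntry g : ℤ) : ZMod (p ^ (n + 1))) = (b : ZMod (p ^ (n + 1))))
    (hnd : (l.map fun g => ((bEntry g : ℤ) : ZMod (p ^ (n + 2)))).Nodup)
    (hd : dEntry δ = (p : ℤ) ^ n) (hb : ((bEntry δ : ℤ) : ZMod (p ^ n)) = (b : ZMod (p ^ n))) :
    l.prod * δ ∈ heckePImages N p :=
  ⟨n, b, l, δ, hlen, hl, hnd, hd, hb, rfl⟩

/-- The B⁰ subgroup is contained in the B⁰_ss subgroup. [cite: Manin1972, Prop. 1.4] -/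
theorem closure_sup_commutator_le (N p : ℕ) :
    Subgroup.closure (teichSpanGenerators N p) ⊔ commutator (Gamma0 N) ≤
      Subgroup.closure (teichSpanHeckeGenerators N p) ⊔ commutator (Gamma0 N) :=
  sup_le_sup_right (Subgroup.closure_mono (teichSpanGenerators_subset N p)) _

/-- **B⁰ ⟹ B⁰_ss** at one pair `(N,p)`: `TeichSpanGen N p → TeichSpanGenModHecke N p` (more generators). [cite: Manin1972, Prop. 1.4] -/
theorem teichSpanGenModHecke_of_teichSpanGen {N p : ℕ} (h : TeichSpanGen N p) : TeichSpanGenModHecke N p :=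
  fun γ hγ ↦ closure_sup_commutator_le N p (h γ hγ)

/-- **B⁰ at all levels ⟹ B⁰_ss at all levels**: `TeichSpanGenAll → TeichSpanGenModHeckeAll`. [cite: Manin1972, Prop. 1.4] -/
theorem teichSpanGenModHeckeAll_of_teichSpanGenAll (h : TeichSpanGenAll) : TeichSpanGenModHeckeAll :=
  fun N p hp hp5 hpN ↦ teichSpanGenModHecke_of_teichSpanGen (h N p hp hp5 hpN)

/-! ### Appended (gen 10, second cut): B⁰ modulo an ARBITRARY relator set, and the `T_ℓ`-images (`ℓ ≠ p`)

The dictionary only uses of a relator `R` that Manin's homomorphism of the newform kills it mod `p` once `[0]⁺ ≡ 0`; so the natural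
hypothesis is «B⁰ modulo `G`» for any set `G ⊆ Γ₀(N)` of such relators.  Besides the `T_p`-images (`a_p ≡ 0`), every prime `ℓ ∤ Np`
with `a_ℓ(f) ≡ 0 (mod p)` contributes its `T_ℓ`-images — for the crux's population (`ρ̄_{E,p}` with image the normaliser of a non-split
Cartan, quadratic field `K`) that is EVERY good prime inert in `K`: the hinge then only concerns the `K`-dihedral residually
supersingular eigensystems of level `N_E`. -/

/-- **B⁰ modulo a relator set `G`** — `TeichSpanGenMod N p G`: for every good `γ ∈ Γ₀(N)` the `ι`-norm `γ·γ^ι` lies in the subgroup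
generated by the B⁰ generators `teichSpanGenerators N p` and `G`, times the commutator subgroup.  `G = ∅` is CONJ B⁰
(`teichSpanGenMod_empty_iff`), `G = heckePImages N p` is B⁰_ss (`teichSpanGenModHecke_iff_teichSpanGenMod`).  A PREDICATE; nothing asserted.
[cite: Manin1972, Prop. 1.4] [cite: MazurTateTeitelbaum1986Invent, §I.4 (4.2)] -/
def TeichSpanGenMod (N p : ℕ) (G : Set (Gamma0 N)) : Prop :=
  ∀ γ : Gamma0 N, IsGoodAt p γ →
    γ * iotaGamma0 γ ∈ Subgroup.closure (teichSpanGenerators N p ∪ G) ⊔ commutator (Gamma0 N)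

/-- **The `T_ℓ`-images (`ℓ` a prime, `ℓ ≠ p`, `ℓ ∤ N`) of the `p`-power cusp classes, as elements of `Γ₀(N)`.**  For `n ≥ 0`, an integer
`b` and `v = (b mod pⁿ)`: a product `g_0 ⋯ g_{ℓ-1} · g_ℓ` where, for `j < ℓ`, `g_j ∈ Γ₀(N)` carries the cusp `(v/pⁿ + j)/ℓ = (v + j pⁿ)/(ℓ pⁿ)`
— `d(g_j) = ℓ pⁿ`, `b(g_j) ≡ v + j pⁿ (mod ℓ pⁿ)` if `ℓ ∤ v + j pⁿ`, and the REDUCED cusp `d(g_j) = pⁿ`, `ℓ·b(g_j) ≡ b (mod pⁿ)` for the one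
`j` with `ℓ ∣ v + j pⁿ` — and `g_ℓ` carries `ℓ·b/pⁿ` (`d = pⁿ`, `b(g_ℓ) ≡ ℓ b`).  Under Manin's map this is
`Σ_j {0 → (b/pⁿ + j)/ℓ} + {0 → ℓ b/pⁿ} = T_ℓ{0 → b/pⁿ} + Σ_{0<j<ℓ} {0 → j/ℓ}` (MTT (4.2) `T_ℓ = Σ_j (1 j; 0 ℓ) + (ℓ 0; 0 1)` on paths from `0`),
with Manin value `2(a_ℓ[v/pⁿ]⁺ − (ℓ+1)[0]⁺)` for an eigenform.  A SET; nothing asserted.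
[cite: MazurTateTeitelbaum1986Invent, §I.4 (4.2)] [cite: Manin1972, Prop. 1.4] -/
def heckeLImages (N p ℓ : ℕ) : Set (Gamma0 N) :=
  {R | ∃ (n : ℕ) (b : ℤ) (g : Fin ℓ → Gamma0 N) (gℓ : Gamma0 N),
    (∀ j : Fin ℓ,
      (¬ ℓ ∣ (b : ZMod (p ^ n)).val + (j : ℕ) * p ^ n ∧ dEntry (g j) = (ℓ : ℤ) * (p : ℤ) ^ n ∧
          ((bEntry (g j) : ℤ) : ZMod (ℓ * p ^ n)) = (((b : ZMod (p ^ n)).val + (j : ℕ) * p ^ n : ℕ) : ZMod (ℓ * p ^ n))) ∨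
      (ℓ ∣ (b : ZMod (p ^ n)).val + (j : ℕ) * p ^ n ∧ dEntry (g j) = (p : ℤ) ^ n ∧
          (ℓ : ZMod (p ^ n)) * ((bEntry (g j) : ℤ) : ZMod (p ^ n)) = (b : ZMod (p ^ n)))) ∧
    dEntry gℓ = (p : ℤ) ^ n ∧ ((bEntry gℓ : ℤ) : ZMod (p ^ n)) = (ℓ : ZMod (p ^ n)) * (b : ZMod (p ^ n)) ∧
    R = (List.ofFn g).prod * gℓ}

/-- Unfolding `TeichSpanGenMod`. [cite: Manin1972, Prop. 1.4] -/
theorem teichSpanGenMod_iff (N p : ℕ) (G : Set (Gamma0 N)) :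
    TeichSpanGenMod N p G ↔ ∀ γ : Gamma0 N, IsGoodAt p γ →
      γ * iotaGamma0 γ ∈ Subgroup.closure (teichSpanGenerators N p ∪ G) ⊔ commutator (Gamma0 N) := Iff.rfl

/-- **Monotonicity in the relator set**: `G ⊆ G' → TeichSpanGenMod N p G → TeichSpanGenMod N p G'`. [cite: Manin1972, Prop. 1.4] -/
theorem teichSpanGenMod_mono {N p : ℕ} {G G' : Set (Gamma0 N)} (hGG' : G ⊆ G') (h : TeichSpanGenMod N p G) :
    TeichSpanGenMod N p G' :=
  fun γ hγ ↦ sup_le_sup_right (Subgroup.closure_mono (Set.union_subset_union_right _ hGG')) _ (h γ hγ)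

/-- `G = ∅`: B⁰ modulo nothing is CONJ B⁰. [cite: Manin1972, Prop. 1.4] -/
theorem teichSpanGenMod_empty_iff (N p : ℕ) : TeichSpanGenMod N p (∅ : Set (Gamma0 N)) ↔ TeichSpanGen N p := by
  simp only [TeichSpanGenMod, Set.union_empty]
  rfl

/-- CONJ B⁰ implies B⁰ modulo any relator set. [cite: Manin1972, Prop. 1.4] -/
theorem teichSpanGenMod_of_teichSpanGen {N p : ℕ} (G : Set (Gamma0 N)) (h : TeichSpanGen N p) : TeichSpanGenMod N p G :=
  teichSpanGenMod_mono (Set.empty_subset G) ((teichSpanGenMod_empty_iff N p).mpr h)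

/-- B⁰_ss is B⁰ modulo the `T_p`-images: `TeichSpanGenModHecke N p ↔ TeichSpanGenMod N p (heckePImages N p)`.
[cite: MazurTateTeitelbaum1986Invent, §I.4 (4.2)] -/
theorem teichSpanGenModHecke_iff_teichSpanGenMod (N p : ℕ) :
    TeichSpanGenModHecke N p ↔ TeichSpanGenMod N p (heckePImages N p) := Iff.rfl

/-- Constructor for `heckeLImages`. [cite: MazurTateTeitelbaum1986Invent, §I.4 (4.2)] -/
theorem prod_mul_mem_heckeLImages {p ℓ : ℕ} (n : ℕ) (b : ℤ) {g : Fin ℓ → Gamma0 N} {gℓ : Gamma0 N}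
    (hg : ∀ j : Fin ℓ,
      (¬ ℓ ∣ (b : ZMod (p ^ n)).val + (j : ℕ) * p ^ n ∧ dEntry (g j) = (ℓ : ℤ) * (p : ℤ) ^ n ∧
          ((bEntry (g j) : ℤ) : ZMod (ℓ * p ^ n)) = (((b : ZMod (p ^ n)).val + (j : ℕ) * p ^ n : ℕ) : ZMod (ℓ * p ^ n))) ∨
      (ℓ ∣ (b : ZMod (p ^ n)).val + (j : ℕ) * p ^ n ∧ dEntry (g j) = (p : ℤ) ^ n ∧
          (ℓ : ZMod (p ^ n)) * ((bEntry (g j) : ℤ) : ZMod (p ^ n)) = (b : ZMod (p ^ n))))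
    (hd : dEntry gℓ = (p : ℤ) ^ n) (hb : ((bEntry gℓ : ℤ) : ZMod (p ^ n)) = (ℓ : ZMod (p ^ n)) * (b : ZMod (p ^ n))) :
    (List.ofFn g).prod * gℓ ∈ heckeLImages N p ℓ :=
  ⟨n, b, g, gℓ, hg, hd, hb, rfl⟩

end Summit.BirchSwinnertonDyer.BirchSwinnertonDyer.Theorems.SmallImageTeichSpanHecke

end
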